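/-
Copyright: statement-level skeleton of a published paper (lit-balaban cell, Phase-2 proof seat p26 gen 46). No claims beyond
what the kernel checks below.
-/
import Mathlib
import Literature.MathematicalPhysics.QuantumFieldTheory.Balaban1983to89.B3GraphAmplitudeSignedPositionForm
import Literature.MathematicalPhysics.QuantumFieldTheory.Balaban1983to89.B2Ineq329ZeroAveraging

/-!
# B3 — T. Bałaban, *(Higgs)₂,₃ quantum fields in a finite volume. III. Renormalization*, CMP **88** (1983) 411–445
[Balaban1983Higgs3] — p. 426 [PDF 16] with the catalogue (1.6)–(1.15) pp. 413–414 and p. 420 [PDF 10] (`d_s(v)`, `d_v(v)`): **THE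
VERTEX BOUNDS OF THE FIRST ESTIMATE (2.13) FROM THE PRINTED VERTICES** — p19's hypothesis `u_le` (*"The external fields are estimated
further by the Hölder norms … in vertices we apply the inequalities |q| ≦ 1, |R_{n̄+1}(·)| ≦ 1"*, couplings `e^{d_v(v)}λ^{d_s(v)}` and the
*"proper power"* `η^{e_v}`) DISCHARGED for the vertex functions of FILE 12 (`uOfKind`) and FILE 14 (`UOf`) of ALL NINE kinds from sup-norm
bounds on the model and localization data (FILE 20 of the Feynman-rule evaluator lineage; item (U) of `HOME/lit-balaban-p26/DESIGN-B3-evaluator.md`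
§ g46).

statement-level skeleton of published theorems with citation tags; proofs where landed; nothing here is a claim about
the Yang–Mills mass gap

PDF held: `paper:balaban1983-higgs-2-3-quantum-fields-finite-volume` (journal page = PDF page + 410); pp. 413–414 [PDF 3–4], p. 420
[PDF 10] and p. 426 [PDF 16] read by this seat on the text layer `~/.lit/texts/paper-balaban1983-higgs-2-3-quantum-fields-finite-volume/`
(2026-08-25).

CITATION HEADER (lean-in-tree rule).  lit-balaban TYPED SKELETON (HOME `run/shared/lean/pub/lit-balaban/`), PHASE 2, seat p26 gen 46
(unit `lit-balaban-p26`; free-target protocol G.5-34(d), own lane).  ROWS **B3.Eq2.13-2.14** ((2.13) p. 426; head `proved` by p19's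
`B3Ineq213Proof`), **B3.Prop1** (p. 420), **B3.Def@420** and **B3.Eq1.6-1.11 ∕ 1.12-1.15** (the catalogue) of `HOME/lit-balaban-r15/ROWS-B3.md`
(fold owner r15; this file is an OPTIONAL located member, cells only, zero head weight).  CONSUMES BY NAME, nothing re-declared: FILE 12
`B3GraphAmplitudePositionForm`: `u16`, `u17`, `u18`, `u19`, `u110`, `u111`, `u113`, `u114`, `u115`, `bondData`, `bondData_nonneg`, `uOfKind`,
`uOfKind_nonneg`, `extAt`; FILE 14 `B3GraphAmplitudeSignedPositionForm`: `UOf`, `UOf_nonneg`, `UOf_le_uOfKind`; FILE 2's `Model`, `Loc`;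
r15's `B3Prop1.VertexKind` with `etaCount`, `etaCount_nonneg`, `Admissible`, `diffCount`, `ds`, `dv`; `B3Cor23Concrete.Graph` (`kind`, `adm`); the
typer's `HiggsLattice.{Params, Params.mesh, mesh_pos, Site, PBond}`; `HiggsAveraging.blockIter`; `B2Ineq329ZeroAveraging.mesh_eq` (`L^kε = L^k·ε`).

THE PRINTED TEXT (verbatim).  p. 426 [PDF 16]: *"We estimate it taking absolute values of all factors. The external fields are estimated
further by the Hölder norms … Finally in vertices we apply the inequalities |q| ≦ 1, |R_{n̄+1}(·)| ≦ 1."*; p. 420 [PDF 10]: *"Let us denote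
by d_s(v) an order of the coupling constant λ for the vertex v, and by d_v(v) an order of the coupling constant e."*; (2.13):
*"O(1)(e(L^kε))^{d_v(G)}(λ(L^kε))^{d_s(G)} … ‖hΦ_ext‖₁‖h′A_ext‖₁ …, where O(1) is a constant depending on n̄ only"*; (2.14) p. 427: the vertex
factor *"(L^{j(v)}η)^{d + (a proper power of L^{j(v)}η; e.g. …)}"* — p19's `e_v ≥ 0`.

WHY THIS FILE ∕ READING (declared).  p19's class `B3Ineq213Amplitude.Amp` takes the vertex bound as the hypothesis
`u_le : |u_v(x)| ≤ e^{d_v(v)} λ^{d_s(v)} N^Φ_v N^A_v η^{e_v}` (`η = L^{−k}`), with `η^d u_v(x_v) = U_v(c_v x_v)` for the packaged amplitudes of FILE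
12 §7 (`ampOf`: `u_v = η^{−d}·U_v∘c_v`); FILE 12 ∕ 14 ∕ 18 ∕ 19 carry it as the hypothesis `u_le : |(L^k)^d·(U_v(x)·extAt_v(x))| ≤ …` for the
vertex functions `U_v = uOfKind_v` (FILE 12) resp. `UOf_v` (FILE 14, the signed form: no `η⁻¹`).  THIS FILE DISCHARGES IT from SUP-NORM BOUNDS
on the data (the `DataBounds` record: `|w| ≤ W` for the localization weights — p. 420's indicators and partitions of unity —, `|g_k| ≤ 1` for
the cut-off of (1.4), `|Ã_b| ≤ N_Ã`, `|Ã(Γ_{·,x})| ≤ N_Γ`, `|δm²_i(x)| ≤ D_m`), kind by kind over FILE 12's explicit `u16 … u115`: for the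
site ∕ bond kinds (1.6)–(1.11) `uOfKind_κ(x)·ε^{diffCount κ} ≤ |e|^{d_v(κ)}|λ|^{d_s(κ)}·vConst_κ·ε^{d + extraEta κ}` with print's EXTRA
`η`-POWER `extraEta κ` (`n+n′−1` for (1.8), `n+n̄` for (1.9), `n+n′−2` for (1.10), `n+n̄−1` for (1.11); `= etaCount κ − d` of r15's catalogue,
`extraEta_eq`) and an explicit coupling-free constant `vConst_κ` (`W`, `½D_m(L^kε)²W`, `d·W·N_Ã^{n′}∕(n!n′!)`, …); for the point kinds
(1.13)–(1.15) `(L^k)^d·uOfKind_κ(x) ≤ |e|^{d_v(κ)}·vConst_κ` with `vConst_κ` carrying `(L^k)^d|w_avg|` (`= 1` for the averaging weight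
`w_avg = η^d = L^{−kd}` of FILE 2's `Model.w`) and `N_Γ^{n′}∕(n!n′!)`.  With FILE 14's `UOf_le_uOfKind` (`UOf_κ ≤ N²ε^{diffCount κ}uOfKind_κ`) and
the scale identity `(L^k)^d ε^{d+E} = (L^kε)^{d+E}·(L^{−k})^E` this gives, for `L^kε ≤ 1` and `d + extraEta κ ≥ 0`,
**`(L^k)^d·UOf_κ(x) ≤ N²·vConst_κ·|e|^{d_v(κ)}|λ|^{d_s(κ)}·(L^{−k})^{extraEta κ}`** (`scaled_UOf_le`) — p19's `u_le` shape with `N^Φ_v·N^A_v :=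
N²·vConst_κ·N^ext_v`, `e_v := extraEta κ ≥ 0` (printed admissibility), `eRun := |e|`, `lamRun := |λ|` — and the graph-level discharge
**`u_le_of_dataBounds`** for the vertex functions `UOf_v·extAt_v` of FILE 14 ∕ 19 under per-vertex sup bounds `|extAt_v| ≤ N^ext_v` of the
external data.

WHAT IS TYPED ∕ PROVED (definitions with bodies + theorems; no `Prop` fact, no `sorry`; standard axioms).  §1 `extraEta`, `extraEta_eq`,
`d_add_extraEta_nonneg`, `extraEta_nonneg_of_admissible`, `DataBounds` (a record of sup-norm hypotheses; inhabited by the sup norms for every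
datum with `|g_k| ≤ 1`: `DataBounds.ofSup`, `supAbs`, `abs_le_supAbs`), `DataBounds.W_nonneg ∕ NAt_nonneg ∕ Nτ_nonneg ∕ Dm_nonneg`, `vConst`, `vConst_nonneg`,
`bondData_le`; §2 the nine per-kind bounds `uOfKind_v16_le` … `uOfKind_v115_le` and the dispatches `uOfKind_siteBond_le` ∕ `uOfKind_point_le`;
§3 `scale_identity` (`(L^k)^d ε^{d+E} = (L^kε)^{d+E}(L^{−k})^E`), `mesh_zpow_le_one`, **`scaled_UOf_le`** (all nine kinds, zpow form) and
`scaled_UOf_le_rpow`; §4 **`u_le_of_dataBounds`** (p19's `u_le` for `UOf_v·extAt_v`, graph level),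
`extraEta_kind_nonneg` (p19's `e_nonneg`, `n̄ ≥ 1`), `nPhi_nonneg`, `NE_nonneg` (p19's `NPhi_nonneg` ∕ `NA_nonneg`).
HONEST SCOPE.  (a) Pure bookkeeping (triangle inequality, sup norms).  Print's *"|q| ≦ 1, |R_{n̄+1}(·)| ≦ 1"* are NOT hypotheses of this
file: they are already applied INSIDE FILE 12's vertex functions `u16 … u115` — through r15's `B3VertexTensorBounds.norm_qpow_mul_remOp_le_one`
(the R-vertices (1.9), (1.11), (1.15); FILE 12's `norm_qpow_mul_remTensor_le_one`) and the typer's `ChargeData.norm_q_le` (FILE 9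
`B3GraphAmplitudeMajorant` §3) — the file of record for print's `q`, `R_{n̄+1}` being r15's `B3VertexTensorBounds`; `DataBounds.g_le : |g_k| ≤ 1` is
the cut-off function of (1.4), a different datum.  The sup-norm hypotheses are the consumer's (for print's data: `w` = indicators ∕ partitions
of unity so `W = 1`, `0 ≤ g_k ≤ 1`, `Ã` small; `DataBounds.ofSup` inhabits the record for any datum with `|g_k| ≤ 1`).  (b) WHERE THE
O(1) GOES: p19's `Amp` has no per-vertex constant slot; the constant `N²·vConst_κ` (channels, factorials, `d`, weights, `(L^kε)²` of (1.7),
`(L^k)^d|w_avg|`) is placed in the norm slot `N^Φ_v` (a non-negative real per vertex, *"1 if none"* in p19's docstring) — print's *"O(1) …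
depending on n̄ only"* times `‖hΦ_ext‖‖h′A_ext‖`; the split of `(L^kε)`-powers between the running couplings `e(L^kε)`, `λ(L^kε)` ((1.29)–(1.30))
and the norms is NOT reproduced: `eRun := |e|`, `lamRun := |λ|` are the model's bare constants and the factor `(L^kε)^{d+extraEta} ≤ 1` is
dropped.  (c) The exponent condition `d + extraEta κ ≥ 0` of §3 holds for all printed admissible parameters and `d ≥ 1` (r15's
`etaCount_nonneg`; discharged inside §4 from `Graph.adm`); p19's `e_nonneg` (`e_v = extraEta κ ≥ 0`) needs `n̄ ≥ 1` (r15's `Admissible`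
with `n̄ = 0` admits the vertex (1.11)_{0,0}, `extraEta = −1`) — `extraEta_nonneg_of_admissible`.  (d) The counterterm vertex (1.7) carries its coupling order inside `δm²` ((1.29)); here `d_s = d_v = 0` for it (r15's
reading) and `|δm²| ≤ D_m` sits in the constant.  (e) Nothing about the lines (FILEs 16–19) or the external-leg contractions `hΦ/hA/hΨ`.
Unit `lit-balaban-p26` gen 46 (literature-prover-lit-balaban-p26-g46-0), HOME `run/shared/lean/pub/lit-balaban/`, 2026-08-25.
-/

open Finset
open scoped BigOperators

namespace Literature.MathematicalPhysics.QuantumFieldTheory.Balaban1983to89.B3Ineq213VertexBounds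

open Literature.MathematicalPhysics.QuantumFieldTheory.Balaban1983to89.B3Cor23Concrete (Graph)
open Literature.MathematicalPhysics.QuantumFieldTheory.Balaban1983to89.B3GraphAmplitude
open Literature.MathematicalPhysics.QuantumFieldTheory.Balaban1983to89.B3GraphAmplitudeRules
open Literature.MathematicalPhysics.QuantumFieldTheory.Balaban1983to89.B3GraphAmplitudePositionForm
open Literature.MathematicalPhysics.QuantumFieldTheory.Balaban1983to89.B3GraphAmplitudeSignedPositionForm
open Literature.MathematicalPhysics.QuantumFieldTheory.Balaban1983to89.B3Prop1 (VertexKind)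
open Literature.MathematicalPhysics.QuantumFieldTheory.Balaban1983to89.HiggsAveraging (blockIter)

noncomputable section

/-! ## §1 The printed exponents and constants of the vertices; the sup-norm data bounds -/

section Data

variable {P : HiggsLattice.Params} {N k : ℕ}

/-- **Print's EXTRA `η`-POWER of a vertex beyond the `η^d` of its lattice sum** — `η^{n+n′−1}` in (1.8)_{n,n′}, `η^{n+n̄}` in (1.9),
`η^{n+n′−2}` in (1.10)_{n,n′}, `η^{n+n̄−1}` in (1.11), none in (1.6), (1.7), (1.13)–(1.15) (over `ℤ`, the printed polynomial expressions);
p19's `e_v` ((2.14): *"a proper power of L^{j(v)}η"*). [cite: Balaban1983Higgs3, (1.6)–(1.15) pp.413–414] [cite: Balaban1983Higgs3, (2.14) p.427] -/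
def extraEta : VertexKind → ℤ
  | .v18 n n' => (n + n' : ℤ) - 1
  | .v19 n nb => (n + nb : ℤ)
  | .v110 n n' => (n + n' : ℤ) - 2
  | .v111 n nb => (n + nb : ℤ) - 1
  | _ => 0

/-- The extra power is r15's total `η`-count minus the space dimension: `extraEta κ = etaCount d κ − d`.
[cite: Balaban1983Higgs3, (1.6)–(1.15) pp.413–414] -/
theorem extraEta_eq (d : ℕ) (κ : VertexKind) : extraEta κ = κ.etaCount d - d := by
  cases κ <;> simp [extraEta, VertexKind.etaCount] <;> ring

/-- For the printed admissible parameters (`Graph.adm`) and `d ≥ 1` the total `η`-exponent `d + extraEta κ` of a vertex is `≥ 0`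
(r15's `etaCount_nonneg`). [cite: Balaban1983Higgs3, (1.6)–(1.15) pp.413–414] -/
theorem d_add_extraEta_nonneg {d nbar : ℕ} (hd : 1 ≤ d) (κ : VertexKind) (hκ : κ.Admissible nbar) :
    0 ≤ (d : ℤ) + extraEta κ := by
  have h := VertexKind.etaCount_nonneg d nbar hd κ hκ
  rw [extraEta_eq d]
  linarith

/-- For `n̄ ≥ 1` every admissible vertex has `extraEta κ ≥ 0` ((1.8): `n + n′ ≥ 1`; (1.10): `n + n′ ≥ 2`; (1.9), (1.11): `n̄_R = n̄ ≥ 1`) —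
p19's `e_nonneg` for `e_v := extraEta(kind v)`. [cite: Balaban1983Higgs3, (1.6)–(1.15) pp.413–414] -/
theorem extraEta_nonneg_of_admissible {nbar : ℕ} (hn : 1 ≤ nbar) (κ : VertexKind) (hκ : κ.Admissible nbar) : 0 ≤ extraEta κ := by
  cases κ <;> simp [VertexKind.Admissible, extraEta] at * <;> omega

/-- **SUP-NORM BOUNDS ON THE DATA OF A VERTEX** (p. 426: *"The external fields are estimated further by the Hölder norms"*; p. 420's
localization weights): the localization weights of the three species by `W`, the cut-off `g_k` of (1.4) by `1`, the external vector field
`Ã` on bonds by `NAt`, its contour sums `Ã(Γ_{·,x})` by `Nτ`, the counterterm `δm²_i` by `Dm`. [cite: Balaban1983Higgs3, p.426]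
[cite: Balaban1983Higgs3, p.420] -/
structure DataBounds (M : Model P N k) (dm2 : HiggsLattice.Site P 0 → ℝ) (l : Loc P k) where
  /-- sup of the localization weights `|w_S|, |w_B|, |w_Y|` -/
  W : ℝ
  /-- sup of `|Ã_b|` -/
  NAt : ℝ
  /-- sup of `|Ã(Γ_{·,x})|` -/
  Nτ : ℝ
  /-- sup of `|δm²_i(x)|` -/
  Dm : ℝ
  wS_le : ∀ x, |l.wS x| ≤ W
  wB_le : ∀ b, |l.wB b| ≤ W
  wY_le : ∀ y, |l.wY y| ≤ W
  g_le : ∀ x, |M.g x| ≤ 1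
  At_le : ∀ b, |M.At b| ≤ NAt
  τ_le : ∀ x, |M.τ x| ≤ Nτ
  dm2_le : ∀ x, |dm2 x| ≤ Dm

namespace DataBounds

variable {M : Model P N k} {dm2 : HiggsLattice.Site P 0 → ℝ} {l : Loc P k} (B : DataBounds M dm2 l)

/-- `W ≥ 0`. [cite: Balaban1983Higgs3, p.420] -/
theorem W_nonneg : 0 ≤ B.W := (abs_nonneg _).trans (B.wS_le default)

/-- `NAt ≥ 0`. [cite: Balaban1983Higgs3, p.426] -/
theorem NAt_nonneg : 0 ≤ B.NAt := (abs_nonneg _).trans (B.At_le ⟨default, ⟨0, P.hd⟩⟩)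

/-- `Nτ ≥ 0`. [cite: Balaban1983Higgs3, p.426] -/
theorem Nτ_nonneg : 0 ≤ B.Nτ := (abs_nonneg _).trans (B.τ_le default)

/-- `Dm ≥ 0`. [cite: Balaban1983Higgs3, p.426] -/
theorem Dm_nonneg : 0 ≤ B.Dm := (abs_nonneg _).trans (B.dm2_le default)

/-- The sup norm `max |f|` of a datum on a finite index set (sites, bonds, block points of the torus). [cite: Balaban1983Higgs3, p.426] -/
def supAbs {α : Type*} [Fintype α] (f : α → ℝ) : ℝ := ((Finset.univ.sup fun a => ‖f a‖₊ : NNReal) : ℝ)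

/-- `|f a| ≤ max |f|`. [cite: Balaban1983Higgs3, p.426] -/
theorem abs_le_supAbs {α : Type*} [Fintype α] (f : α → ℝ) (a : α) : |f a| ≤ supAbs f := by
  have h : ‖f a‖₊ ≤ Finset.univ.sup fun a => ‖f a‖₊ := Finset.le_sup (f := fun a => ‖f a‖₊) (Finset.mem_univ a)
  have h' : (‖f a‖₊ : ℝ) ≤ ((Finset.univ.sup fun a => ‖f a‖₊ : NNReal) : ℝ) := NNReal.coe_le_coe.mpr h
  rwa [coe_nnnorm, Real.norm_eq_abs] at h'

/-- **THE RECORD IS INHABITED FOR EVERY DATUM WITH `|g_k| ≤ 1`** — the only genuine condition (the cut-off of (1.4) takes values in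
`[0, 1]`); on the finite torus the weights, `Ã`, `Ã(Γ)` and `δm²` are bounded by their sup norms. [cite: Balaban1983Higgs3, p.426]
[cite: Balaban1983Higgs3, (1.4) p.412] -/
def ofSup (M : Model P N k) (dm2 : HiggsLattice.Site P 0 → ℝ) (l : Loc P k) (hg : ∀ x, |M.g x| ≤ 1) : DataBounds M dm2 l where
  W := max (supAbs l.wS) (max (supAbs l.wB) (supAbs l.wY))
  NAt := supAbs M.At
  Nτ := supAbs M.τ
  Dm := supAbs dm2
  wS_le x := (abs_le_supAbs l.wS x).trans (le_max_left _ _)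
  wB_le b := (abs_le_supAbs l.wB b).trans ((le_max_left _ _).trans (le_max_right _ _))
  wY_le y := (abs_le_supAbs l.wY y).trans ((le_max_right _ _).trans (le_max_right _ _))
  g_le := hg
  At_le := abs_le_supAbs M.At
  τ_le := abs_le_supAbs M.τ
  dm2_le := abs_le_supAbs dm2

/-- The sup-norm record has `W = max(max|w_S|, max|w_B|, max|w_Y|)`. [cite: Balaban1983Higgs3, p.420] -/
theorem ofSup_W (M : Model P N k) (dm2 : HiggsLattice.Site P 0 → ℝ) (l : Loc P k) (hg : ∀ x, |M.g x| ≤ 1) :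
    (ofSup M dm2 l hg).W = max (supAbs l.wS) (max (supAbs l.wB) (supAbs l.wY)) := rfl

/-- `|g_k(x)|^n ≤ 1`. [cite: Balaban1983Higgs3, (1.4) p.412] -/
theorem abs_g_pow_le_one (B : DataBounds M dm2 l) (n : ℕ) (x : HiggsLattice.Site P 0) : |M.g x| ^ n ≤ 1 :=
  pow_le_one₀ (abs_nonneg _) (B.g_le x)

/-- The bond data of a bond vertex is at most `d·W·NAt^{n′}` (`d` bonds start at the site). [cite: Balaban1983Higgs3, (1.8) p.413] -/
theorem bondData_le [DecidableEq (HiggsLattice.PBond P 0)] (n' : ℕ) (x : HiggsLattice.Site P 0) :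
    bondData M.At n' M.S l.wB x ≤ (P.d : ℝ) * (B.W * B.NAt ^ n') := by
  unfold bondData
  have hterm : ∀ μ : Fin P.d, (if (⟨x, μ⟩ : HiggsLattice.PBond P 0) ∈ M.S then (1 : ℝ) else 0) *
      (|l.wB ⟨x, μ⟩| * |M.At ⟨x, μ⟩| ^ n') ≤ B.W * B.NAt ^ n' := by
    intro μ
    have h1 : (if (⟨x, μ⟩ : HiggsLattice.PBond P 0) ∈ M.S then (1 : ℝ) else 0) ≤ 1 := by split_ifs <;> norm_num
    have h2 : |l.wB ⟨x, μ⟩| * |M.At ⟨x, μ⟩| ^ n' ≤ B.W * B.NAt ^ n' :=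
      mul_le_mul (B.wB_le _) (pow_le_pow_left₀ (abs_nonneg _) (B.At_le _) n') (by positivity) B.W_nonneg
    calc (if (⟨x, μ⟩ : HiggsLattice.PBond P 0) ∈ M.S then (1 : ℝ) else 0) * (|l.wB ⟨x, μ⟩| * |M.At ⟨x, μ⟩| ^ n')
        ≤ 1 * (B.W * B.NAt ^ n') := mul_le_mul h1 h2 (by positivity) zero_le_one
      _ = B.W * B.NAt ^ n' := one_mul _
  calc ∑ μ : Fin P.d, (if (⟨x, μ⟩ : HiggsLattice.PBond P 0) ∈ M.S then (1 : ℝ) else 0) * (|l.wB ⟨x, μ⟩| * |M.At ⟨x, μ⟩| ^ n')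
      ≤ ∑ _μ : Fin P.d, B.W * B.NAt ^ n' := Finset.sum_le_sum fun μ _ => hterm μ
    _ = (P.d : ℝ) * (B.W * B.NAt ^ n') := by rw [Finset.sum_const, Finset.card_univ, Fintype.card_fin, nsmul_eq_mul]

end DataBounds

variable {M : Model P N k} {dm2 : HiggsLattice.Site P 0 → ℝ} {l : Loc P k}

/-- **The coupling-free CONSTANT of a vertex** after *"taking absolute values of all factors"*, `|q| ≦ 1`, `|R_{n̄+1}| ≦ 1`, `|U| = 1` and the
sup norms: `W` for (1.6); `½D_m(L^kε)²W` for (1.7); `d·W·NAt^{n′}∕(n!n′!)` for (1.8)/(1.10) (`NAt^{n̄+1}`, `(n̄+1)!` for the R-vertices (1.9)/(1.11));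
`(L^k)^d|w_avg|·W` for (1.13) and `·N_Γ^{n′}∕(n!n′!)` for (1.14)/(1.15) — everything except the couplings `|e|^{d_v}`, `|λ|^{d_s}` and the
`η`-powers. [cite: Balaban1983Higgs3, (1.6)–(1.15) pp.413–414] [cite: Balaban1983Higgs3, (2.13) p.426] -/
def vConst (B : DataBounds M dm2 l) : VertexKind → ℝ
  | .v16 => B.W
  | .v17 => 1 / 2 * B.Dm * M.ell ^ 2 * B.W
  | .v18 n n' => (P.d : ℝ) * (B.W * B.NAt ^ n') / ((n.factorial : ℝ) * n'.factorial)
  | .v19 n nb => (P.d : ℝ) * (B.W * B.NAt ^ (nb + 1)) / ((n.factorial : ℝ) * (nb + 1).factorial)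
  | .v110 n n' => (P.d : ℝ) * (B.W * B.NAt ^ n') / ((n.factorial : ℝ) * n'.factorial)
  | .v111 n nb => (P.d : ℝ) * (B.W * B.NAt ^ (nb + 1)) / ((n.factorial : ℝ) * (nb + 1).factorial)
  | .v113 => ((P.L : ℝ) ^ k) ^ P.d * |M.w| * B.W
  | .v114 n n' => ((P.L : ℝ) ^ k) ^ P.d * |M.w| * (B.W * B.Nτ ^ n') / ((n.factorial : ℝ) * n'.factorial)
  | .v115 n nb => ((P.L : ℝ) ^ k) ^ P.d * |M.w| * (B.W * B.Nτ ^ (nb + 1)) / ((n.factorial : ℝ) * (nb + 1).factorial)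

/-- `vConst ≥ 0`. [cite: Balaban1983Higgs3, (2.13) p.426] -/
theorem vConst_nonneg (B : DataBounds M dm2 l) (κ : VertexKind) : 0 ≤ vConst B κ := by
  have hW := B.W_nonneg
  have hA := B.NAt_nonneg
  have hτ := B.Nτ_nonneg
  have hD := B.Dm_nonneg
  cases κ <;> simp only [vConst] <;> positivity

end Data

/-! ## §2 The nine vertex functions of FILE 12 against the sup norms -/

section Kinds

variable {P : HiggsLattice.Params} {N k : ℕ} [DecidableEq (HiggsLattice.PBond P 0)]
variable {M : Model P N k} {dm2 : HiggsLattice.Site P 0 → ℝ} {l : Loc P k} (B : DataBounds M dm2 l)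

omit [DecidableEq (HiggsLattice.PBond P 0)] in
/-- kernel: an indicator is at most `1`. [folklore] -/
private theorem ind_le_one (p : Prop) [Decidable p] : (if p then (1 : ℝ) else 0) ≤ 1 := by split_ifs <;> norm_num

omit [DecidableEq (HiggsLattice.PBond P 0)] in
/-- kernel: an indicator is non-negative. [folklore] -/
private theorem ind_nonneg (p : Prop) [Decidable p] : 0 ≤ (if p then (1 : ℝ) else 0) := by split_ifs <;> norm_num

/-- **(1.6)**: `u16(x) ≤ |λ|·W·ε^d`. [cite: Balaban1983Higgs3, (1.6) p.413] -/
theorem uOfKind_v16_le (x : HiggsLattice.Site P 0) :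
    uOfKind M dm2 l .v16 x ≤ |M.lamRun| * vConst B .v16 * P.mesh 0 ^ P.d := by
  have hm : 0 < P.mesh 0 ^ P.d := pow_pos (P.mesh_pos 0) _
  show u16 M.lamRun M.Ω₁ l.wS x ≤ |M.lamRun| * B.W * P.mesh 0 ^ P.d
  unfold u16
  calc |M.lamRun| * (P.mesh 0 ^ P.d * |l.wS x|) * (if x ∈ M.Ω₁ then (1 : ℝ) else 0)
      ≤ |M.lamRun| * (P.mesh 0 ^ P.d * B.W) * 1 :=
        mul_le_mul (mul_le_mul_of_nonneg_left (mul_le_mul_of_nonneg_left (B.wS_le x) hm.le) (abs_nonneg _))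
          (ind_le_one _) (ind_nonneg _) (by have := B.W_nonneg; positivity)
    _ = |M.lamRun| * B.W * P.mesh 0 ^ P.d := by ring

/-- **(1.7)**: `u17(x) ≤ ½D_m(L^kε)²W·ε^d`. [cite: Balaban1983Higgs3, (1.7) p.413] -/
theorem uOfKind_v17_le (x : HiggsLattice.Site P 0) :
    uOfKind M dm2 l .v17 x ≤ vConst B .v17 * P.mesh 0 ^ P.d := by
  have hm : 0 < P.mesh 0 ^ P.d := pow_pos (P.mesh_pos 0) _
  show u17 dm2 M.ell M.Ω₁ l.wS x ≤ 1 / 2 * B.Dm * M.ell ^ 2 * B.W * P.mesh 0 ^ P.d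
  unfold u17
  have h1 : P.mesh 0 ^ P.d * |dm2 x| * M.ell ^ 2 * |l.wS x| ≤ P.mesh 0 ^ P.d * B.Dm * M.ell ^ 2 * B.W := by
    have := B.Dm_nonneg
    exact mul_le_mul (mul_le_mul_of_nonneg_right (mul_le_mul_of_nonneg_left (B.dm2_le x) hm.le) (sq_nonneg _))
      (B.wS_le x) (abs_nonneg _) (by positivity)
  calc 1 / 2 * (P.mesh 0 ^ P.d * |dm2 x| * M.ell ^ 2 * |l.wS x|) * (if x ∈ M.Ω₁ then (1 : ℝ) else 0)
      ≤ 1 / 2 * (P.mesh 0 ^ P.d * B.Dm * M.ell ^ 2 * B.W) * 1 :=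
        mul_le_mul (mul_le_mul_of_nonneg_left h1 (by norm_num)) (ind_le_one _) (ind_nonneg _)
          (by have := B.Dm_nonneg; have := B.W_nonneg; positivity)
    _ = 1 / 2 * B.Dm * M.ell ^ 2 * B.W * P.mesh 0 ^ P.d := by ring

/-- kernel: `ε^a·(ε^d·ε⁻¹)·ε = ε^{d+a}` (integer powers). [folklore] -/
private theorem zpow_helper1 {m : ℝ} (hm : m ≠ 0) (a : ℤ) (d : ℕ) :
    m ^ a * (m ^ d * m⁻¹) * m = m ^ ((d : ℤ) + a) := by
  calc m ^ a * (m ^ d * m⁻¹) * m = m ^ a * (m ^ (d : ℤ) * m ^ (-1 : ℤ)) * m ^ (1 : ℤ) := by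
        rw [zpow_natCast, zpow_neg_one, zpow_one]
    _ = m ^ (a + ((d : ℤ) + (-1)) + 1) := by rw [← zpow_add₀ hm, ← zpow_add₀ hm, ← zpow_add₀ hm]
    _ = m ^ ((d : ℤ) + a) := by congr 1; ring

/-- kernel: `ε^a·(ε^d·ε⁻¹)·ε = ε^{d+a}` (natural power `a`). [folklore] -/
private theorem zpow_helper2 {m : ℝ} (hm : m ≠ 0) (a d : ℕ) :
    m ^ a * (m ^ d * m⁻¹) * m = m ^ ((d : ℤ) + (a : ℤ)) := by
  rw [← zpow_helper1 hm (a : ℤ) d, zpow_natCast]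

/-- kernel: `ε^a·ε^d = ε^{d+a}` (integer power `a`). [folklore] -/
private theorem zpow_helper3 {m : ℝ} (hm : m ≠ 0) (a : ℤ) (d : ℕ) : m ^ a * m ^ d = m ^ ((d : ℤ) + a) := by
  rw [← zpow_natCast, ← zpow_add₀ hm, add_comm]

/-- **(1.8)_{n,n′}** (one `ε` restored for the difference quotient, FILE 14's `diffCount = 1`):
`u18(x)·ε ≤ |e|^{n+n′}·d·W·NAt^{n′}∕(n!n′!)·ε^{d+n+n′−1}`. [cite: Balaban1983Higgs3, (1.8) p.413] -/
theorem uOfKind_v18_le (n n' : ℕ) (x : HiggsLattice.Site P 0) :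
    uOfKind M dm2 l (.v18 n n') x * P.mesh 0 ≤
      |M.C.e| ^ (n + n') * vConst B (.v18 n n') * P.mesh 0 ^ ((P.d : ℤ) + extraEta (.v18 n n')) := by
  have hm : 0 < P.mesh 0 := P.mesh_pos 0
  show u18 M.C M.g M.At n n' M.S l.wB x * P.mesh 0 ≤
    |M.C.e| ^ (n + n') * ((P.d : ℝ) * (B.W * B.NAt ^ n') / ((n.factorial : ℝ) * n'.factorial)) *
      P.mesh 0 ^ ((P.d : ℤ) + ((n + n' : ℤ) - 1))
  unfold u18
  have hg := B.abs_g_pow_le_one n x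
  have hbd := B.bondData_le n' x
  have hbd0 := bondData_nonneg M.At n' M.S l.wB x
  have hz := zpow_helper1 hm.ne' ((n + n' : ℤ) - 1) P.d
  have hfac : 0 < (n.factorial : ℝ) * n'.factorial := by positivity
  calc |M.C.e| ^ (n + n') * (P.mesh 0 ^ ((n + n' : ℤ) - 1) / ((n.factorial : ℝ) * n'.factorial)) *
        ((P.mesh 0 ^ P.d * (P.mesh 0)⁻¹ * |M.g x| ^ n) * bondData M.At n' M.S l.wB x) * P.mesh 0
      = |M.C.e| ^ (n + n') / ((n.factorial : ℝ) * n'.factorial) *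
          (P.mesh 0 ^ ((n + n' : ℤ) - 1) * (P.mesh 0 ^ P.d * (P.mesh 0)⁻¹) * P.mesh 0) *
          (|M.g x| ^ n * bondData M.At n' M.S l.wB x) := by ring
    _ ≤ |M.C.e| ^ (n + n') / ((n.factorial : ℝ) * n'.factorial) * P.mesh 0 ^ ((P.d : ℤ) + ((n + n' : ℤ) - 1)) *
          (1 * ((P.d : ℝ) * (B.W * B.NAt ^ n'))) := by
        rw [hz]
        exact mul_le_mul_of_nonneg_left (mul_le_mul hg hbd hbd0 zero_le_one)
          (mul_nonneg (by positivity) (zpow_nonneg hm.le _))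
    _ = _ := by ring

/-- **(1.9)_{n̄,n}** (the R-vertex of (1.8); one `ε` restored): `u19(x)·ε ≤ |e|^{n+n̄+1}·d·W·NAt^{n̄+1}∕(n!(n̄+1)!)·ε^{d+n+n̄}`.
[cite: Balaban1983Higgs3, (1.9) p.413] -/
theorem uOfKind_v19_le (n nb : ℕ) (x : HiggsLattice.Site P 0) :
    uOfKind M dm2 l (.v19 n nb) x * P.mesh 0 ≤
      |M.C.e| ^ (n + nb + 1) * vConst B (.v19 n nb) * P.mesh 0 ^ ((P.d : ℤ) + extraEta (.v19 n nb)) := by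
  have hm : 0 < P.mesh 0 := P.mesh_pos 0
  show u19 M.C M.g M.At nb n M.S l.wB x * P.mesh 0 ≤
    |M.C.e| ^ (n + nb + 1) * ((P.d : ℝ) * (B.W * B.NAt ^ (nb + 1)) / ((n.factorial : ℝ) * (nb + 1).factorial)) *
      P.mesh 0 ^ ((P.d : ℤ) + (n + nb : ℤ))
  unfold u19
  have hg := B.abs_g_pow_le_one n x
  have hbd := B.bondData_le (nb + 1) x
  have hbd0 := bondData_nonneg M.At (nb + 1) M.S l.wB x
  have hz := zpow_helper2 hm.ne' (n + nb) P.d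
  have hfac : 0 < (n.factorial : ℝ) * (nb + 1).factorial := by positivity
  calc |M.C.e| ^ (n + nb + 1) * (P.mesh 0 ^ (n + nb) / ((n.factorial : ℝ) * (nb + 1).factorial)) *
        ((P.mesh 0 ^ P.d * (P.mesh 0)⁻¹ * |M.g x| ^ n) * bondData M.At (nb + 1) M.S l.wB x) * P.mesh 0
      = |M.C.e| ^ (n + nb + 1) / ((n.factorial : ℝ) * (nb + 1).factorial) *
          (P.mesh 0 ^ (n + nb) * (P.mesh 0 ^ P.d * (P.mesh 0)⁻¹) * P.mesh 0) *
          (|M.g x| ^ n * bondData M.At (nb + 1) M.S l.wB x) := by ring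
    _ ≤ |M.C.e| ^ (n + nb + 1) / ((n.factorial : ℝ) * (nb + 1).factorial) * P.mesh 0 ^ ((P.d : ℤ) + (n + nb : ℤ)) *
          (1 * ((P.d : ℝ) * (B.W * B.NAt ^ (nb + 1)))) := by
        rw [hz, Nat.cast_add]
        exact mul_le_mul_of_nonneg_left (mul_le_mul hg hbd hbd0 zero_le_one)
          (mul_nonneg (by positivity) (zpow_nonneg hm.le _))
    _ = _ := by ring

/-- **(1.10)_{n,n′}**: `u110(x) ≤ |e|^{n+n′}·d·W·NAt^{n′}∕(n!n′!)·ε^{d+n+n′−2}`. [cite: Balaban1983Higgs3, (1.10) p.413] -/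
theorem uOfKind_v110_le (n n' : ℕ) (x : HiggsLattice.Site P 0) :
    uOfKind M dm2 l (.v110 n n') x ≤
      |M.C.e| ^ (n + n') * vConst B (.v110 n n') * P.mesh 0 ^ ((P.d : ℤ) + extraEta (.v110 n n')) := by
  have hm : 0 < P.mesh 0 := P.mesh_pos 0
  show u110 M.C M.g M.At n n' M.S l.wB x ≤
    |M.C.e| ^ (n + n') * ((P.d : ℝ) * (B.W * B.NAt ^ n') / ((n.factorial : ℝ) * n'.factorial)) *
      P.mesh 0 ^ ((P.d : ℤ) + ((n + n' : ℤ) - 2))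
  unfold u110
  have hg := B.abs_g_pow_le_one n x
  have hbd := B.bondData_le n' x
  have hbd0 := bondData_nonneg M.At n' M.S l.wB x
  have hz := zpow_helper3 hm.ne' ((n + n' : ℤ) - 2) P.d
  have hfac : 0 < (n.factorial : ℝ) * n'.factorial := by positivity
  calc |M.C.e| ^ (n + n') * (P.mesh 0 ^ ((n + n' : ℤ) - 2) / ((n.factorial : ℝ) * n'.factorial)) *
        ((P.mesh 0 ^ P.d * |M.g x| ^ n) * bondData M.At n' M.S l.wB x)
      = |M.C.e| ^ (n + n') / ((n.factorial : ℝ) * n'.factorial) * (P.mesh 0 ^ ((n + n' : ℤ) - 2) * P.mesh 0 ^ P.d) *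
          (|M.g x| ^ n * bondData M.At n' M.S l.wB x) := by ring
    _ ≤ |M.C.e| ^ (n + n') / ((n.factorial : ℝ) * n'.factorial) * P.mesh 0 ^ ((P.d : ℤ) + ((n + n' : ℤ) - 2)) *
          (1 * ((P.d : ℝ) * (B.W * B.NAt ^ n'))) := by
        rw [hz]
        exact mul_le_mul_of_nonneg_left (mul_le_mul hg hbd hbd0 zero_le_one)
          (mul_nonneg (by positivity) (zpow_nonneg hm.le _))
    _ = _ := by ring

/-- **(1.11)_{n̄,n}** (the R-vertex of (1.10)): `u111(x) ≤ |e|^{n+n̄+1}·d·W·NAt^{n̄+1}∕(n!(n̄+1)!)·ε^{d+n+n̄−1}`.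
[cite: Balaban1983Higgs3, (1.11) p.413] -/
theorem uOfKind_v111_le (n nb : ℕ) (x : HiggsLattice.Site P 0) :
    uOfKind M dm2 l (.v111 n nb) x ≤
      |M.C.e| ^ (n + nb + 1) * vConst B (.v111 n nb) * P.mesh 0 ^ ((P.d : ℤ) + extraEta (.v111 n nb)) := by
  have hm : 0 < P.mesh 0 := P.mesh_pos 0
  show u111 M.C M.g M.At nb n M.S l.wB x ≤
    |M.C.e| ^ (n + nb + 1) * ((P.d : ℝ) * (B.W * B.NAt ^ (nb + 1)) / ((n.factorial : ℝ) * (nb + 1).factorial)) *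
      P.mesh 0 ^ ((P.d : ℤ) + ((n + nb : ℤ) - 1))
  unfold u111
  have hg := B.abs_g_pow_le_one n x
  have hbd := B.bondData_le (nb + 1) x
  have hbd0 := bondData_nonneg M.At (nb + 1) M.S l.wB x
  have hz := zpow_helper3 hm.ne' ((n + nb : ℤ) - 1) P.d
  have hfac : 0 < (n.factorial : ℝ) * (nb + 1).factorial := by positivity
  calc |M.C.e| ^ (n + nb + 1) * (P.mesh 0 ^ ((n + nb : ℤ) - 1) / ((n.factorial : ℝ) * (nb + 1).factorial)) *
        ((P.mesh 0 ^ P.d * |M.g x| ^ n) * bondData M.At (nb + 1) M.S l.wB x)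
      = |M.C.e| ^ (n + nb + 1) / ((n.factorial : ℝ) * (nb + 1).factorial) * (P.mesh 0 ^ ((n + nb : ℤ) - 1) * P.mesh 0 ^ P.d) *
          (|M.g x| ^ n * bondData M.At (nb + 1) M.S l.wB x) := by ring
    _ ≤ |M.C.e| ^ (n + nb + 1) / ((n.factorial : ℝ) * (nb + 1).factorial) * P.mesh 0 ^ ((P.d : ℤ) + ((n + nb : ℤ) - 1)) *
          (1 * ((P.d : ℝ) * (B.W * B.NAt ^ (nb + 1)))) := by
        rw [hz]
        exact mul_le_mul_of_nonneg_left (mul_le_mul hg hbd hbd0 zero_le_one)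
          (mul_nonneg (by positivity) (zpow_nonneg hm.le _))
    _ = _ := by ring

omit [DecidableEq (HiggsLattice.PBond P 0)] in
/-- **(1.13)**: `(L^k)^d·u113(x) ≤ (L^k)^d|w_avg|·W` (`|U| = 1`). [cite: Balaban1983Higgs3, (1.13) p.413] -/
theorem uOfKind_v113_le [DecidableEq (HiggsLattice.PBond P 0)] (x : HiggsLattice.Site P 0) :
    ((P.L : ℝ) ^ k) ^ P.d * uOfKind M dm2 l .v113 x ≤ vConst B .v113 := by
  have hL : 0 ≤ ((P.L : ℝ) ^ k) ^ P.d := by positivity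
  show ((P.L : ℝ) ^ k) ^ P.d * u113 M.w M.Y l.wY x ≤ ((P.L : ℝ) ^ k) ^ P.d * |M.w| * B.W
  unfold u113
  calc ((P.L : ℝ) ^ k) ^ P.d * (|M.w| * |l.wY (blockIter k x)| * (if blockIter k x ∈ M.Y then (1 : ℝ) else 0))
      ≤ ((P.L : ℝ) ^ k) ^ P.d * (|M.w| * B.W * 1) :=
        mul_le_mul_of_nonneg_left (mul_le_mul (mul_le_mul_of_nonneg_left (B.wY_le _) (abs_nonneg _)) (ind_le_one _)
          (ind_nonneg _) (mul_nonneg (abs_nonneg _) B.W_nonneg)) hL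
    _ = ((P.L : ℝ) ^ k) ^ P.d * |M.w| * B.W := by ring

omit [DecidableEq (HiggsLattice.PBond P 0)] in
/-- **(1.14)_{n,n′}**: `(L^k)^d·u114(x) ≤ |e|^{n+n′}·(L^k)^d|w_avg|·W·N_Γ^{n′}∕(n!n′!)` (`|q| ≦ 1`, `|U| = 1`). [cite: Balaban1983Higgs3, (1.14) p.413] -/
theorem uOfKind_v114_le [DecidableEq (HiggsLattice.PBond P 0)] (n n' : ℕ) (x : HiggsLattice.Site P 0) :
    ((P.L : ℝ) ^ k) ^ P.d * uOfKind M dm2 l (.v114 n n') x ≤ |M.C.e| ^ (n + n') * vConst B (.v114 n n') := by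
  have hL : 0 ≤ ((P.L : ℝ) ^ k) ^ P.d := by positivity
  show ((P.L : ℝ) ^ k) ^ P.d * u114 M.C M.w M.τ n n' M.Y l.wY x ≤
    |M.C.e| ^ (n + n') * (((P.L : ℝ) ^ k) ^ P.d * |M.w| * (B.W * B.Nτ ^ n') / ((n.factorial : ℝ) * n'.factorial))
  unfold u114
  have hτ : |M.τ x| ^ n' ≤ B.Nτ ^ n' := pow_le_pow_left₀ (abs_nonneg _) (B.τ_le x) n'
  have hfac : 0 < (n.factorial : ℝ) * n'.factorial := by positivity
  have hW := B.W_nonneg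
  have hNτ := B.Nτ_nonneg
  have h1 : |M.w| * |M.τ x| ^ n' * |l.wY (blockIter k x)| * (if blockIter k x ∈ M.Y then (1 : ℝ) else 0) ≤
      |M.w| * B.Nτ ^ n' * B.W * 1 :=
    mul_le_mul (mul_le_mul (mul_le_mul_of_nonneg_left hτ (abs_nonneg _)) (B.wY_le _) (abs_nonneg _) (by positivity))
      (ind_le_one _) (ind_nonneg _) (by positivity)
  calc ((P.L : ℝ) ^ k) ^ P.d * (|M.C.e| ^ (n + n') * (1 / ((n.factorial : ℝ) * n'.factorial)) * (|M.w| * |M.τ x| ^ n') *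
        |l.wY (blockIter k x)| * (if blockIter k x ∈ M.Y then (1 : ℝ) else 0))
      = ((P.L : ℝ) ^ k) ^ P.d * (|M.C.e| ^ (n + n') / ((n.factorial : ℝ) * n'.factorial)) *
          (|M.w| * |M.τ x| ^ n' * |l.wY (blockIter k x)| * (if blockIter k x ∈ M.Y then (1 : ℝ) else 0)) := by ring
    _ ≤ ((P.L : ℝ) ^ k) ^ P.d * (|M.C.e| ^ (n + n') / ((n.factorial : ℝ) * n'.factorial)) * (|M.w| * B.Nτ ^ n' * B.W * 1) :=
        mul_le_mul_of_nonneg_left h1 (by positivity)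
    _ = _ := by ring

omit [DecidableEq (HiggsLattice.PBond P 0)] in
/-- **(1.15)_{n̄,n}** (the R-vertex of (1.14): `|q^m R_{n̄+1}(·)| ≦ 1`): `(L^k)^d·u115(x) ≤ |e|^{n+n̄+1}·(L^k)^d|w_avg|·W·N_Γ^{n̄+1}∕(n!(n̄+1)!)`.
[cite: Balaban1983Higgs3, (1.15) p.414] -/
theorem uOfKind_v115_le [DecidableEq (HiggsLattice.PBond P 0)] (n nb : ℕ) (x : HiggsLattice.Site P 0) :
    ((P.L : ℝ) ^ k) ^ P.d * uOfKind M dm2 l (.v115 n nb) x ≤ |M.C.e| ^ (n + nb + 1) * vConst B (.v115 n nb) := by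
  have hL : 0 ≤ ((P.L : ℝ) ^ k) ^ P.d := by positivity
  show ((P.L : ℝ) ^ k) ^ P.d * u115 M.C M.w M.τ nb n M.Y l.wY x ≤
    |M.C.e| ^ (n + nb + 1) * (((P.L : ℝ) ^ k) ^ P.d * |M.w| * (B.W * B.Nτ ^ (nb + 1)) / ((n.factorial : ℝ) * (nb + 1).factorial))
  unfold u115
  have hτ : |M.τ x| ^ (nb + 1) ≤ B.Nτ ^ (nb + 1) := pow_le_pow_left₀ (abs_nonneg _) (B.τ_le x) (nb + 1)
  have hfac : 0 < (n.factorial : ℝ) * (nb + 1).factorial := by positivity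
  have hW := B.W_nonneg
  have hNτ := B.Nτ_nonneg
  have h1 : |M.w| * |M.τ x| ^ (nb + 1) * |l.wY (blockIter k x)| * (if blockIter k x ∈ M.Y then (1 : ℝ) else 0) ≤
      |M.w| * B.Nτ ^ (nb + 1) * B.W * 1 :=
    mul_le_mul (mul_le_mul (mul_le_mul_of_nonneg_left hτ (abs_nonneg _)) (B.wY_le _) (abs_nonneg _) (by positivity))
      (ind_le_one _) (ind_nonneg _) (by positivity)
  calc ((P.L : ℝ) ^ k) ^ P.d * (|M.C.e| ^ (n + nb + 1) * (1 / ((n.factorial : ℝ) * (nb + 1).factorial)) *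
        (|M.w| * |M.τ x| ^ (nb + 1)) * |l.wY (blockIter k x)| * (if blockIter k x ∈ M.Y then (1 : ℝ) else 0))
      = ((P.L : ℝ) ^ k) ^ P.d * (|M.C.e| ^ (n + nb + 1) / ((n.factorial : ℝ) * (nb + 1).factorial)) *
          (|M.w| * |M.τ x| ^ (nb + 1) * |l.wY (blockIter k x)| * (if blockIter k x ∈ M.Y then (1 : ℝ) else 0)) := by ring
    _ ≤ ((P.L : ℝ) ^ k) ^ P.d * (|M.C.e| ^ (n + nb + 1) / ((n.factorial : ℝ) * (nb + 1).factorial)) *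
          (|M.w| * B.Nτ ^ (nb + 1) * B.W * 1) :=
        mul_le_mul_of_nonneg_left h1 (by positivity)
    _ = _ := by ring

/-- **THE SITE ∕ BOND KINDS (1.6)–(1.11), one statement**: `uOfKind_κ(x)·ε^{diffCount κ} ≤ |e|^{d_v(κ)}·|λ|^{d_s(κ)}·vConst_κ·ε^{d + extraEta κ}`.
[cite: Balaban1983Higgs3, (1.6)–(1.11) p.413] [cite: Balaban1983Higgs3, p.420] -/
theorem uOfKind_siteBond_le (κ : VertexKind) (hκ : speciesOf κ ≠ .point) (x : HiggsLattice.Site P 0) :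
    uOfKind M dm2 l κ x * P.mesh 0 ^ κ.diffCount ≤
      |M.C.e| ^ κ.dv * |M.lamRun| ^ κ.ds * vConst B κ * P.mesh 0 ^ ((P.d : ℤ) + extraEta κ) := by
  cases κ with
  | v16 =>
    simp only [VertexKind.diffCount, VertexKind.dv, VertexKind.ds, extraEta, pow_zero, pow_one, mul_one, one_mul, add_zero,
      zpow_natCast]
    exact uOfKind_v16_le B x
  | v17 =>
    simp only [VertexKind.diffCount, VertexKind.dv, VertexKind.ds, extraEta, pow_zero, mul_one, one_mul, add_zero, zpow_natCast]
    exact uOfKind_v17_le B x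
  | v18 n n' =>
    simp only [VertexKind.diffCount, VertexKind.dv, VertexKind.ds, pow_zero, pow_one, mul_one]
    exact uOfKind_v18_le B n n' x
  | v19 n nb =>
    simp only [VertexKind.diffCount, VertexKind.dv, VertexKind.ds, pow_zero, pow_one, mul_one]
    exact uOfKind_v19_le B n nb x
  | v110 n n' =>
    simp only [VertexKind.diffCount, VertexKind.dv, VertexKind.ds, pow_zero, mul_one]
    exact uOfKind_v110_le B n n' x
  | v111 n nb =>
    simp only [VertexKind.diffCount, VertexKind.dv, VertexKind.ds, pow_zero, mul_one]
    exact uOfKind_v111_le B n nb x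
  | v113 => exact absurd rfl hκ
  | v114 n n' => exact absurd rfl hκ
  | v115 n nb => exact absurd rfl hκ

/-- **THE POINT KINDS (1.13)–(1.15), one statement**: `(L^k)^d·uOfKind_κ(x) ≤ |e|^{d_v(κ)}·|λ|^{d_s(κ)}·vConst_κ` (no `η`-power: the
averaging weight `w_avg = η^d` is part of the data). [cite: Balaban1983Higgs3, (1.13)–(1.15) pp.413–414] [cite: Balaban1983Higgs3, p.420] -/
theorem uOfKind_point_le (κ : VertexKind) (hκ : speciesOf κ = .point) (x : HiggsLattice.Site P 0) :
    ((P.L : ℝ) ^ k) ^ P.d * uOfKind M dm2 l κ x ≤ |M.C.e| ^ κ.dv * |M.lamRun| ^ κ.ds * vConst B κ := by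
  cases κ with
  | v113 =>
    simp only [VertexKind.dv, VertexKind.ds, pow_zero, one_mul]
    exact uOfKind_v113_le B x
  | v114 n n' =>
    simp only [VertexKind.dv, VertexKind.ds, pow_zero, mul_one]
    exact uOfKind_v114_le B n n' x
  | v115 n nb =>
    simp only [VertexKind.dv, VertexKind.ds, pow_zero, mul_one]
    exact uOfKind_v115_le B n nb x
  | _ => simp [speciesOf] at hκ

end Kinds

/-! ## §3 The signed vertex functions `UOf` of FILE 14, scaled by `(L^k)^d`: p19's `u_le` shape, all nine kinds -/

section Scaled

variable {P : HiggsLattice.Params} {N k : ℕ} [DecidableEq (HiggsLattice.PBond P 0)]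
variable {M : Model P N k} {dm2 : HiggsLattice.Site P 0 → ℝ} {l : Loc P k} (B : DataBounds M dm2 l)

omit [DecidableEq (HiggsLattice.PBond P 0)] in
/-- **THE SCALE IDENTITY** behind the *"proper power of L^{j(v)}η"*: `(L^k)^d · ε^{d+E} = (L^kε)^{d+E} · (L^{−k})^E` — the `η`-powers of a
vertex in the model's mesh `ε` are the factor `(L^kε)^{d+E} ≤ 1` times print's `η^{E}`, `η = L^{−k}`. [cite: Balaban1983Higgs3, (2.14) p.427]
[cite: Balaban1983Higgs3, (1.1) p.412] -/
theorem scale_identity (E : ℤ) :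
    ((P.L : ℝ) ^ k) ^ P.d * P.mesh 0 ^ ((P.d : ℤ) + E) = P.mesh k ^ ((P.d : ℤ) + E) * (((P.L : ℝ) ^ k)⁻¹) ^ E := by
  have hL : (0 : ℝ) < (P.L : ℝ) ^ k := pow_pos (by exact_mod_cast P.hL) k
  rw [B2Ineq329ZeroAveraging.mesh_eq k, mul_zpow, inv_zpow', mul_assoc, mul_comm (P.mesh 0 ^ ((P.d : ℤ) + E)), ← mul_assoc,
    ← zpow_add₀ hL.ne', show (P.d : ℤ) + E + -E = (P.d : ℤ) by ring, zpow_natCast]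

omit [DecidableEq (HiggsLattice.PBond P 0)] in
/-- `(L^kε)^{d+E} ≤ 1` for `L^kε ≤ 1` and `d + E ≥ 0`. [cite: Balaban1983Higgs3, (1.1) p.412] -/
theorem mesh_zpow_le_one (hmesh : P.mesh k ≤ 1) {E : ℤ} (hE : 0 ≤ (P.d : ℤ) + E) : P.mesh k ^ ((P.d : ℤ) + E) ≤ 1 := by
  obtain ⟨m, hm⟩ := Int.eq_ofNat_of_zero_le hE
  rw [hm, zpow_natCast]
  exact pow_le_one₀ (P.mesh_pos k).le hmesh

/-- **THE VERTEX BOUND OF (2.13) FOR THE SIGNED VERTEX FUNCTIONS, ALL NINE KINDS**: for `L^kε ≤ 1` and `d + extraEta κ ≥ 0`,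
`(L^k)^d · UOf_κ(x) ≤ N² · vConst_κ · |e|^{d_v(κ)} |λ|^{d_s(κ)} · (L^{−k})^{extraEta κ}` — FILE 14's `UOf_le_uOfKind`, §2, and the scale identity
(the factor `(L^kε)^{d+extraEta κ} ≤ 1` dropped for the site ∕ bond kinds). This is p19's `u_le` for one vertex with `eRun := |e|`,
`lamRun := |λ|`, `N^Φ_v·N^A_v := N²·vConst_κ`, `e_v := extraEta κ`. [cite: Balaban1983Higgs3, (2.13) p.426] [cite: Balaban1983Higgs3, (2.14) p.427]
[cite: Balaban1983Higgs3, p.420] -/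
theorem scaled_UOf_le (hmesh : P.mesh k ≤ 1) (κ : VertexKind) (hκ : 0 ≤ (P.d : ℤ) + extraEta κ) (x : HiggsLattice.Site P 0) :
    ((P.L : ℝ) ^ k) ^ P.d * UOf M dm2 l κ x ≤
      (N : ℝ) ^ 2 * vConst B κ * (|M.C.e| ^ κ.dv * |M.lamRun| ^ κ.ds) * (((P.L : ℝ) ^ k)⁻¹) ^ extraEta κ := by
  have hU := UOf_le_uOfKind M dm2 l κ x
  have hLk : 0 ≤ ((P.L : ℝ) ^ k) ^ P.d := by positivity
  have hvC := vConst_nonneg B κ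
  have hm0 : 0 < P.mesh 0 := P.mesh_pos 0
  by_cases hsp : speciesOf κ = .point
  · -- the point kinds: no `η`-power, the averaging weight sits in `vConst`
    have hE : extraEta κ = 0 := by cases κ <;> simp_all [speciesOf, extraEta]
    have hdc : κ.diffCount = 0 := by cases κ <;> simp_all [speciesOf, VertexKind.diffCount]
    rw [hE, zpow_zero, mul_one]
    rw [hdc, pow_zero, mul_one] at hU
    have h1 := uOfKind_point_le B κ hsp x
    calc ((P.L : ℝ) ^ k) ^ P.d * UOf M dm2 l κ x
        ≤ ((P.L : ℝ) ^ k) ^ P.d * ((N : ℝ) ^ 2 * uOfKind M dm2 l κ x) := mul_le_mul_of_nonneg_left hU hLk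
      _ = (N : ℝ) ^ 2 * (((P.L : ℝ) ^ k) ^ P.d * uOfKind M dm2 l κ x) := by ring
      _ ≤ (N : ℝ) ^ 2 * (|M.C.e| ^ κ.dv * |M.lamRun| ^ κ.ds * vConst B κ) := mul_le_mul_of_nonneg_left h1 (by positivity)
      _ = _ := by ring
  · -- the site ∕ bond kinds
    have h1 := uOfKind_siteBond_le B κ hsp x
    have h2 : UOf M dm2 l κ x ≤ (N : ℝ) ^ 2 * (|M.C.e| ^ κ.dv * |M.lamRun| ^ κ.ds * vConst B κ * P.mesh 0 ^ ((P.d : ℤ) + extraEta κ)) := by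
      refine hU.trans ?_
      rw [mul_assoc, mul_comm (P.mesh 0 ^ κ.diffCount)]
      exact mul_le_mul_of_nonneg_left h1 (by positivity)
    have h3 : ((P.L : ℝ) ^ k) ^ P.d * P.mesh 0 ^ ((P.d : ℤ) + extraEta κ) ≤ (((P.L : ℝ) ^ k)⁻¹) ^ extraEta κ := by
      rw [scale_identity]
      exact mul_le_of_le_one_left (zpow_nonneg (inv_nonneg.2 (by positivity)) _) (mesh_zpow_le_one hmesh hκ)
    have hc : 0 ≤ (N : ℝ) ^ 2 * vConst B κ * (|M.C.e| ^ κ.dv * |M.lamRun| ^ κ.ds) := by positivity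
    calc ((P.L : ℝ) ^ k) ^ P.d * UOf M dm2 l κ x
        ≤ ((P.L : ℝ) ^ k) ^ P.d *
            ((N : ℝ) ^ 2 * (|M.C.e| ^ κ.dv * |M.lamRun| ^ κ.ds * vConst B κ * P.mesh 0 ^ ((P.d : ℤ) + extraEta κ))) :=
          mul_le_mul_of_nonneg_left h2 hLk
      _ = (N : ℝ) ^ 2 * vConst B κ * (|M.C.e| ^ κ.dv * |M.lamRun| ^ κ.ds) *
            (((P.L : ℝ) ^ k) ^ P.d * P.mesh 0 ^ ((P.d : ℤ) + extraEta κ)) := by ring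
      _ ≤ _ := mul_le_mul_of_nonneg_left h3 hc

/-- The same with a REAL exponent (p19's `Amp.u_le` carries `e_v : ℝ` and the real power `η^{e_v}`). [cite: Balaban1983Higgs3, (2.14) p.427] -/
theorem scaled_UOf_le_rpow (hmesh : P.mesh k ≤ 1) (κ : VertexKind) (hκ : 0 ≤ (P.d : ℤ) + extraEta κ) (x : HiggsLattice.Site P 0) :
    ((P.L : ℝ) ^ k) ^ P.d * UOf M dm2 l κ x ≤
      (N : ℝ) ^ 2 * vConst B κ * (|M.C.e| ^ κ.dv * |M.lamRun| ^ κ.ds) * (((P.L : ℝ) ^ k)⁻¹) ^ ((extraEta κ : ℤ) : ℝ) := by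
  rw [Real.rpow_intCast]
  exact scaled_UOf_le B hmesh κ hκ x

end Scaled

/-! ## §4 p19's `u_le` for the vertex functions `UOf_v · extAt_v` of a graph (FILE 14 ∕ FILE 19) -/

section GraphLevel

variable {P : HiggsLattice.Params} {N k nbar : ℕ} [DecidableEq (HiggsLattice.PBond P 0)]

/-- **p19's VERTEX HYPOTHESIS `u_le` DISCHARGED FOR THE SIGNED VERTEX FUNCTIONS OF A GRAPH**: for every graph of p18's model, model data
with sup-norm bounds at every vertex (`B v`), `L^kε ≤ 1`, and external data dominated per vertex by `N^ext_v` (`|extAt_v(x)| ≤ N^ext_v`: *"The external fields are estimated further by the Hölder norms"*), the vertex functions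
`U_v = UOf_v·extAt_v` of FILE 14's `abs_graphAmp_le_ampE_signed` ∕ FILE 19's `abs_graphAmp_le_ampE_signed_torusBlocks` satisfy
`|(L^k)^d U_v(x)| ≤ eRun^{d_v(v)} lamRun^{d_s(v)} N^Φ_v N^A_v η^{e_v}` at ALL sites, with `eRun = |e|`, `lamRun = |λ|`, `d_v(v) = dv(kind v)`,
`d_s(v) = ds(kind v)` (p. 420), `N^Φ_v = N²·vConst_v`, `N^A_v = N^ext_v`, `e_v = extraEta(kind v)`, `η = L^{−k}` — the literal shape of the
hypothesis `u_le` there (the exponent condition `d + extraEta ≥ 0` of §3 is discharged from `G.adm` and `d ≥ 1`; p19's `e_nonneg` is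
`extraEta_kind_nonneg` below). [cite: Balaban1983Higgs3, (2.13) p.426] [cite: Balaban1983Higgs3, (2.14) p.427] [cite: Balaban1983Higgs3, p.420] -/
theorem u_le_of_dataBounds (G : Graph nbar) (Mh : Model P N k) (dm2 : Fin G.nV → HiggsLattice.Site P 0 → ℝ)
    (loc : Fin G.nV → Loc P k) (B : ∀ v, DataBounds Mh (dm2 v) (loc v)) (hmesh : P.mesh k ≤ 1) (Po : OutPairing G)
    (nS : ExtSLeg G → HiggsLattice.Site P 0 → ℝ) (nV : ExtVLeg G → HiggsLattice.Site P 0 → ℝ) (nO : Po.Ext → HiggsLattice.Site P 0 → ℝ)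
    (NE : Fin G.nV → ℝ) (hNE : ∀ v x, |extAt Po nS nV nO v x| ≤ NE v) :
    ∀ v x, |((P.L : ℝ) ^ k) ^ P.d * (UOf Mh (dm2 v) (loc v) (G.kind v) x * extAt Po nS nV nO v x)| ≤
      |Mh.C.e| ^ (G.kind v).dv * |Mh.lamRun| ^ (G.kind v).ds * ((N : ℝ) ^ 2 * vConst (B v) (G.kind v)) * NE v *
        (((P.L : ℝ) ^ k)⁻¹) ^ ((extraEta (G.kind v) : ℤ) : ℝ) := by
  intro v x
  have hE : 0 ≤ (P.d : ℤ) + extraEta (G.kind v) := d_add_extraEta_nonneg P.hd (G.kind v) (G.adm v)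
  have hU0 := UOf_nonneg Mh (dm2 v) (loc v) (G.kind v) x
  have hLk : 0 ≤ ((P.L : ℝ) ^ k) ^ P.d := by positivity
  have hLi : 0 < ((P.L : ℝ) ^ k)⁻¹ := inv_pos.2 (pow_pos (by exact_mod_cast P.hL) k)
  have hvC := vConst_nonneg (B v) (G.kind v)
  rw [abs_mul, abs_mul, abs_of_nonneg hLk, abs_of_nonneg hU0, ← mul_assoc]
  have h1 := scaled_UOf_le_rpow (B v) hmesh (G.kind v) hE x
  have hb : 0 ≤ (N : ℝ) ^ 2 * vConst (B v) (G.kind v) * (|Mh.C.e| ^ (G.kind v).dv * |Mh.lamRun| ^ (G.kind v).ds) *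
      (((P.L : ℝ) ^ k)⁻¹) ^ ((extraEta (G.kind v) : ℤ) : ℝ) :=
    mul_nonneg (by positivity) (Real.rpow_nonneg hLi.le _)
  calc ((P.L : ℝ) ^ k) ^ P.d * UOf Mh (dm2 v) (loc v) (G.kind v) x * |extAt Po nS nV nO v x|
      ≤ ((N : ℝ) ^ 2 * vConst (B v) (G.kind v) * (|Mh.C.e| ^ (G.kind v).dv * |Mh.lamRun| ^ (G.kind v).ds) *
          (((P.L : ℝ) ^ k)⁻¹) ^ ((extraEta (G.kind v) : ℤ) : ℝ)) * NE v := mul_le_mul h1 (hNE v x) (abs_nonneg _) hb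
    _ = _ := by ring

omit [DecidableEq (HiggsLattice.PBond P 0)] in
/-- p19's `e_nonneg` for `e_v := extraEta(kind v)`: every vertex of a graph of p18's model with `n̄ ≥ 1` has `e_v ≥ 0` (as a real number).
[cite: Balaban1983Higgs3, (2.14) p.427] [cite: Balaban1983Higgs3, (1.6)–(1.15) pp.413–414] -/
theorem extraEta_kind_nonneg (G : Graph nbar) (hn : 1 ≤ nbar) (v : Fin G.nV) : (0 : ℝ) ≤ ((extraEta (G.kind v) : ℤ) : ℝ) := by
  exact_mod_cast extraEta_nonneg_of_admissible hn (G.kind v) (G.adm v)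

omit [DecidableEq (HiggsLattice.PBond P 0)] in
/-- p19's `NPhi_nonneg` for `N^Φ_v := N²·vConst_v`. [cite: Balaban1983Higgs3, (2.13) p.426] -/
theorem nPhi_nonneg (G : Graph nbar) (Mh : Model P N k) (dm2 : Fin G.nV → HiggsLattice.Site P 0 → ℝ) (loc : Fin G.nV → Loc P k)
    (B : ∀ v, DataBounds Mh (dm2 v) (loc v)) (v : Fin G.nV) : 0 ≤ (N : ℝ) ^ 2 * vConst (B v) (G.kind v) :=
  mul_nonneg (pow_nonneg (Nat.cast_nonneg _) 2) (vConst_nonneg (B v) (G.kind v))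

omit [DecidableEq (HiggsLattice.PBond P 0)] in
/-- p19's `NA_nonneg` for `N^A_v := N^ext_v`: a bound of an absolute value is `≥ 0`. [cite: Balaban1983Higgs3, (2.13) p.426] -/
theorem NE_nonneg {G : Graph nbar} {Po : OutPairing G} {nS : ExtSLeg G → HiggsLattice.Site P 0 → ℝ}
    {nV : ExtVLeg G → HiggsLattice.Site P 0 → ℝ} {nO : Po.Ext → HiggsLattice.Site P 0 → ℝ} {NE : Fin G.nV → ℝ}
    (hNE : ∀ v x, |extAt Po nS nV nO v x| ≤ NE v) (v : Fin G.nV) : 0 ≤ NE v :=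
  (abs_nonneg _).trans (hNE v default)

end GraphLevel

end

end Literature.MathematicalPhysics.QuantumFieldTheory.Balaban1983to89.B3Ineq213VertexBounds
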